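import Literature.ModelTheory.ExponentialFields.DefinablyCompleteExpPolynomials
import Literature.ModelTheory.ExponentialFields.OrderedExpFieldModels
import Literature.ModelTheory.ExponentialFields.DefinableCompletenessCodes
import Mathlib.Topology.Order.Basic
import HarnessLib

/-!
# Uniform finiteness of exponential-polynomial zero sets in the models of `OEF ∪ [DC]`

Topic `Literature/ModelTheory/ExponentialFields`.  The recursive subtheory
`T₀ = OEF ∪ [DC]` of `Th(ℝ_exp)` — ordered exponential field axioms (`Theory.OEF`,
`OrderedExpFieldModels.lean`) together with the definable completeness scheme
(`DefinableCompleteness.scheme`, shown recursive in `DefinableCompletenessCodes.lean`) — is the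
exponential analogue of the theory `T` of Jones–Servi (*On the decidability of the real field
with a generic power function*, J. Symbolic Logic 76 (2011), Def. 1.2: "[OF]; [DCB]; [DE]; …
Notice that `T` is recursive"), whose model-theoretic analysis (o-minimality of the models,
Fornasiero–Servi 2010, Theorem 8.2 / Corollary 8.3; effective model completeness of the
restricted part) yields Macintyre–Wilkie's theorem `T ∪ Th_∃(ℝ_exp) ⊢ Th(ℝ_exp)` (loc. cit.,
Prop. 3.1).  This file names that theory (`Theory.OEFDC`, with `OEFDC_subset_realExpTheory`,
`OEFDC_isRecursive`) and transports to its models the uniform finiteness theorems proved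
axiomatically in `DefinablyCompleteRolleCount.lean` / `DefinablyCompleteExpPolynomials.lean`:

* **`OEFModel.finite_setOf_unaryExpPoly_eq_zero`** — in every model `K` of `OEF` which is
  definably complete (in particular every model of `OEFDC`), a one-variable exponential
  polynomial `Σ_{j<n} P_j(x) exp(x)^j` with some `P_j ≠ 0` has finitely many zeros, at most
  `Σ_{P_j ≠ 0} (deg P_j + 1) - 1` (Khovanskii's bound for `n = 1`, chain `(exp)`, over definably
  complete fields: Fornasiero–Servi 2010, Theorem 8.4 (1));
* `OEFModel.ncard_setOf_exp_eq_polynomial_le`, `OEFModel.ncard_setOf_exp_eq_linear_le_two` —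
  `exp x = p(x)` has at most `deg p + 1` solutions, `exp x = a x + b` at most two;
* the same for the bundled models of `OEFDC` (`OEFDCModel.*`).

So these instances of o-minimal uniform finiteness — axioms of Berarducci–Servi's recursively
axiomatized o-minimal subtheory `T_omin ⊆ T_exp` (Ann. Pure Appl. Logic 125 (2004), Cor. 2.5),
there justified by truth in `ℝ` — are *theorems* of `OEF ∪ [DC]`.  Ingredients: the
definability, in any lawful `L_exp`-structure, of the graphs of `+`, `·`, `exp` in the shape used
by the definable-calculus files (`definable_graph_add`, …).  Everything is proved; the only
definition is the name `Theory.OEFDC`.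

## References

* G. O. Jones, T. Servi, J. Symbolic Logic 76 (2011), Def. 1.2, Prop. 3.1. [JonesServi2011]
* A. Fornasiero, T. Servi, Fund. Math. 209 (2010), Theorem 8.2, Corollary 8.3, Theorem 8.4.
  [FornasieroServi2010]
* A. Berarducci, T. Servi, Ann. Pure Appl. Logic 125 (2004), Corollary 2.5. [BerarducciServi2004]
-/

noncomputable section

open Set FirstOrder FirstOrder.Language FirstOrder.Language.Structure Polynomial

namespace Literature.ModelTheory.ExponentialFields

universe u v w

/-! ### Graph shapes from definable functions of tuples -/

section Shapes

variable {L : FirstOrder.Language.{u, v}} {M : Type*} [L.Structure M] {A : Set M}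

/-- A definable binary function of tuples has a definable graph in the shape
`{v : Fin 3 → M | v 2 = op (v 0) (v 1)}` of the definable-calculus files. [folklore] -/
theorem definable_graph₂_of_definableFun {op : M → M → M}
    (h : A.DefinableFun L (fun w : Fin 2 → M => op (w 0) (w 1))) :
    A.Definable L {v : Fin 3 → M | v 2 = op (v 0) (v 1)} := by
  have h' := Set.Definable.preimage_comp (fun o : Option (Fin 2) => o.elim (2 : Fin 3) Fin.castSucc)
    (s := Function.tupleGraph fun w : Fin 2 → M => op (w 0) (w 1)) h
  refine (congrArg _ ?_).mpr h'
  ext v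
  simp only [mem_setOf_eq, mem_preimage, Function.tupleGraph, Function.comp_apply,
    Option.elim_none, Option.elim_some, Fin.castSucc_zero, Fin.castSucc_one]
  exact eq_comm

/-- A definable unary function of tuples has a definable graph in the shape
`{v : Fin 2 → M | v 1 = f (v 0)}`. [folklore] -/
theorem definable_graph₁_of_definableFun {f : M → M}
    (h : A.DefinableFun L (fun w : Fin 1 → M => f (w 0))) :
    A.Definable L {v : Fin 2 → M | v 1 = f (v 0)} := by
  have h' := Set.Definable.preimage_comp (fun o : Option (Fin 1) => o.elim (1 : Fin 2) Fin.castSucc)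
    (s := Function.tupleGraph fun w : Fin 1 → M => f (w 0)) h
  refine (congrArg _ ?_).mpr h'
  ext v
  simp only [mem_setOf_eq, mem_preimage, Function.tupleGraph, Function.comp_apply,
    Option.elim_none, Option.elim_some, Fin.castSucc_zero]
  exact eq_comm

end Shapes

/-! ### The graphs of `+`, `·`, `exp`, `<` in a lawful `L_exp`-structure are definable -/

section Lawful

variable {M : Type*} [Language.orderedExpRing.Structure M]

/-- The graph of the interpretation of `exp` is definable (it is a function symbol). [folklore] -/
theorem definable_graph_funMap_exp :
    (univ : Set M).Definable Language.orderedExpRing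
      {v : Fin 2 → M | v 1 = funMap (L := Language.orderedExpRing) expRingFunc.exp ![v 0]} := by
  refine definable_graph₁_of_definableFun (L := Language.orderedExpRing) (A := univ)
    (f := fun a : M => funMap (L := Language.orderedExpRing) expRingFunc.exp ![a])
    (Set.DefinableFun.of_empty ?_)
  have h := (Functions.apply₁ expRingFunc.exp (Term.var (0 : Fin 1)) :
    Language.orderedExpRing.Term (Fin 1)).definableFun_realize (M := M)
  refine (congrArg _ ?_).mpr h
  funext w
  rw [Term.realize_functions_apply₁]
  rfl

variable [Field M] [LinearOrder M] [RealExpModel.LawfulStructure M]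

/-- In a lawful `L_exp`-structure the graph of `+` is definable. [folklore] -/
theorem definable_graph_add :
    (univ : Set M).Definable Language.orderedExpRing {v : Fin 3 → M | v 2 = v 0 + v 1} := by
  refine definable_graph₂_of_definableFun (L := Language.orderedExpRing) (A := univ)
    (op := fun a b : M => a + b) (Set.DefinableFun.of_empty ?_)
  have h := (Term.var (0 : Fin 2) + Term.var 1 :
    Language.orderedExpRing.Term (Fin 2)).definableFun_realize (M := M)
  simp only [ExpTerm.realize_add, Term.realize_var] at h
  exact h

/-- In a lawful `L_exp`-structure the graph of `·` is definable. [folklore] -/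
theorem definable_graph_mul :
    (univ : Set M).Definable Language.orderedExpRing {v : Fin 3 → M | v 2 = v 0 * v 1} := by
  refine definable_graph₂_of_definableFun (L := Language.orderedExpRing) (A := univ)
    (op := fun a b : M => a * b) (Set.DefinableFun.of_empty ?_)
  have h := (Term.var (0 : Fin 2) * Term.var 1 :
    Language.orderedExpRing.Term (Fin 2)).definableFun_realize (M := M)
  simp only [ExpTerm.realize_mul, Term.realize_var] at h
  exact h

end Lawful

/-! ### Uniform finiteness in definably complete models of `OEF` -/

namespace OEFModel

variable (K : Language.Theory.ModelType.{0, 0, w} Theory.OEF)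

/-- The graph of the exponential of a model of `OEF` is definable. [folklore] -/
theorem definable_graph_exp :
    (univ : Set K).Definable Language.orderedExpRing {v : Fin 2 → K | v 1 = exp (v 0)} :=
  definable_graph_funMap_exp

/-- The strict order of a model of `OEF` is definable. [folklore] -/
theorem definable_lt :
    (univ : Set K).Definable Language.orderedExpRing {v : Fin 2 → K | v 0 < v 1} :=
  definable_lt_of_orderedStructure_params

/-- **Uniform finiteness of zeros of one-variable exponential polynomials in definably
complete models of `OEF`**: if `K ⊨ OEF` is definably complete and `P_j ≠ 0` for some
`j < n`, then `{x | Σ_{j<n} P_j(x) exp(x)^j = 0}` is finite with at most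
`Σ_{P_j ≠ 0} (deg P_j + 1) - 1` elements (Khovanskii's bound, `n = 1`, chain `(exp)`, over
definably complete fields: Fornasiero–Servi 2010, Theorem 8.4 (1); the axiomatic proof is
`IsOrderedExp.finite_setOf_unaryExpPoly_eq_zero`). [cite: FornasieroServi2010, Theorem 8.4] -/
theorem finite_setOf_unaryExpPoly_eq_zero
    (hDC : Language.orderedExpRing.IsDefinablyComplete K) (P : ℕ → K[X]) (n : ℕ)
    (hP : ∃ j < n, P j ≠ 0) :
    {x : K | UnaryExpPoly.eval exp P n x = 0}.Finite ∧
      {x : K | UnaryExpPoly.eval exp P n x = 0}.ncard ≤ UnaryExpPoly.budget P n - 1 := by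
  letI : TopologicalSpace K := Preorder.topology K
  haveI : OrderTopology K := ⟨rfl⟩
  exact isOrderedExp_exp.finite_setOf_unaryExpPoly_eq_zero hDC (definable_lt K)
    definable_graph_add definable_graph_mul (definable_graph_exp K) P n hP

/-- **`exp x = p(x)` has at most `deg p + 1` solutions** in a definably complete model of `OEF`.
[cite: FornasieroServi2010, Theorem 8.4] -/
theorem ncard_setOf_exp_eq_polynomial_le
    (hDC : Language.orderedExpRing.IsDefinablyComplete K) (p : K[X]) :
    {x : K | exp x = p.eval x}.Finite ∧ {x : K | exp x = p.eval x}.ncard ≤ p.natDegree + 1 := by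
  letI : TopologicalSpace K := Preorder.topology K
  haveI : OrderTopology K := ⟨rfl⟩
  exact isOrderedExp_exp.finite_setOf_eq_polynomial_eval hDC (definable_lt K)
    definable_graph_add definable_graph_mul (definable_graph_exp K) p

/-- **`exp x = a x + b` has at most two solutions** in a definably complete model of `OEF`.
[folklore] -/
theorem ncard_setOf_exp_eq_linear_le_two
    (hDC : Language.orderedExpRing.IsDefinablyComplete K) (a b : K) :
    {x : K | exp x = a * x + b}.Finite ∧ {x : K | exp x = a * x + b}.ncard ≤ 2 := by
  letI : TopologicalSpace K := Preorder.topology K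
  haveI : OrderTopology K := ⟨rfl⟩
  exact isOrderedExp_exp.ncard_setOf_eq_linear_le_two hDC (definable_lt K)
    definable_graph_add definable_graph_mul (definable_graph_exp K) a b

/-- A model of `OEF` satisfying the definable completeness scheme `[DC]` is definably complete
(`DefinableCompleteness.isDefinablyComplete_of_model`). [cite: FornasieroServi2010, Def. 1.5] -/
theorem isDefinablyComplete_of_model_scheme
    [(K : Type w) ⊨ DefinableCompleteness.scheme Language.orderedExpRing] :
    Language.orderedExpRing.IsDefinablyComplete K :=
  DefinableCompleteness.isDefinablyComplete_of_model

end OEFModel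

/-! ### The recursive subtheory `OEFDC = OEF ∪ [DC]` of `Th(ℝ_exp)` and its models -/

/-- **`OEFDC = OEF ∪ [DC]`**: ordered exponential field axioms plus the definable completeness
scheme — the exponential analogue of Jones–Servi's recursive theory `T` (2011, Def. 1.2:
"[OF] Axioms of ordered field; [DCB] Axioms of definably complete Baire structure; [DE] …"),
without the Baire scheme (redundant for expansions of ordered fields by Hieronymi 2013) and
with `[DE(exp)]` in the form `exp(x + y) = exp x · exp y ∧ x + 1 ≤ exp x` (which forces
`exp' = exp`, `DefinablyCompleteExp.lean`).  A definition (a name for a set of true sentences).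
[cite: JonesServi2011, Def. 1.2] -/
def Theory.OEFDC : Language.orderedExpRing.Theory :=
  Theory.OEF ∪ DefinableCompleteness.scheme Language.orderedExpRing

/-- `OEFDC ⊆ Th(ℝ_exp)`. [folklore] -/
theorem OEFDC_subset_realExpTheory : Theory.OEFDC ⊆ realExpTheory :=
  Set.union_subset OEF_subset_realExpTheory DefinableCompleteness.scheme_subset_realExpTheory

/-- `OEFDC` is recursive (Jones–Servi 2011, after Def. 1.2: "Notice that `T` is recursive").
[cite: JonesServi2011, Def. 1.2] -/
theorem OEFDC_isRecursive : Theory.OEFDC.IsRecursive :=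
  OEF_isRecursive.union DefinableCompleteness.isRecursive_scheme_orderedExpRing

/-- `OEFDC` proves `OEF`. [folklore] -/
theorem modelsOEF_OEFDC : Theory.ModelsOEF Theory.OEFDC :=
  modelsOEF_of_subset Set.subset_union_left

/-- `ℝ_exp ⊨ OEFDC`. [folklore] -/
instance Real.model_OEFDC : ℝ ⊨ Theory.OEFDC :=
  ⟨fun _ hσ => Language.Theory.realize_sentence_of_mem realExpTheory
    (OEFDC_subset_realExpTheory hσ)⟩

namespace OEFDCModel

variable (M : Language.Theory.ModelType.{0, 0, w} Theory.OEFDC)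

/-- A model of `OEFDC` as a model of `OEF` with the same carrier and structure
(`Theory.ModelType.toOEFModel`), so that `OEFModel`'s field structure, order and `exp` apply.
[folklore] -/
abbrev toOEF : Language.Theory.ModelType.{0, 0, w} Theory.OEF :=
  Theory.ModelType.toOEFModel modelsOEF_OEFDC M

/-- A model of `OEFDC` satisfies the scheme `[DC]`. [folklore] -/
instance model_scheme :
    (toOEF M : Type w) ⊨ DefinableCompleteness.scheme Language.orderedExpRing :=
  (show (toOEF M : Type w) ⊨ Theory.OEFDC from M.is_model).mono Set.subset_union_right

/-- **Every model of `OEFDC` is definably complete.** [cite: FornasieroServi2010, Def. 1.5] -/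
theorem isDefinablyComplete : Language.orderedExpRing.IsDefinablyComplete (toOEF M) :=
  OEFModel.isDefinablyComplete_of_model_scheme (toOEF M)

/-- **In every model of the recursive theory `OEFDC ⊆ Th(ℝ_exp)`, a nonzero one-variable
exponential polynomial has finitely many zeros, fewer than its budget** (Fornasiero–Servi 2010,
Theorem 8.4 (1) for `n = 1` and the chain `(exp)`, derived here from `OEF ∪ [DC]` alone).
[cite: FornasieroServi2010, Theorem 8.4] -/
theorem finite_setOf_unaryExpPoly_eq_zero (P : ℕ → (toOEF M)[X]) (n : ℕ)
    (hP : ∃ j < n, P j ≠ 0) :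
    {x : toOEF M | UnaryExpPoly.eval OEFModel.exp P n x = 0}.Finite ∧
      {x : toOEF M | UnaryExpPoly.eval OEFModel.exp P n x = 0}.ncard ≤
        UnaryExpPoly.budget P n - 1 :=
  OEFModel.finite_setOf_unaryExpPoly_eq_zero (toOEF M) (isDefinablyComplete M) P n hP

/-- In every model of `OEFDC`, `exp x = p(x)` has at most `deg p + 1` solutions.
[cite: FornasieroServi2010, Theorem 8.4] -/
theorem ncard_setOf_exp_eq_polynomial_le (p : (toOEF M)[X]) :
    {x : toOEF M | OEFModel.exp x = p.eval x}.Finite ∧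
      {x : toOEF M | OEFModel.exp x = p.eval x}.ncard ≤ p.natDegree + 1 :=
  OEFModel.ncard_setOf_exp_eq_polynomial_le (toOEF M) (isDefinablyComplete M) p

/-- In every model of `OEFDC`, `exp x = a x + b` has at most two solutions. [folklore] -/
theorem ncard_setOf_exp_eq_linear_le_two (a b : toOEF M) :
    {x : toOEF M | OEFModel.exp x = a * x + b}.Finite ∧
      {x : toOEF M | OEFModel.exp x = a * x + b}.ncard ≤ 2 :=
  OEFModel.ncard_setOf_exp_eq_linear_le_two (toOEF M) (isDefinablyComplete M) a b

end OEFDCModel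

/-- The witness of `exists_recursive_subtheory_definablyComplete` made explicit: `OEFDC` is a
recursive subtheory of `Th(ℝ_exp)` containing `OEF` all of whose models are definably complete.
[folklore] -/
theorem OEFDC_recursive_subtheory_definablyComplete :
    Theory.OEFDC ⊆ realExpTheory ∧ Theory.OEFDC.IsRecursive ∧ Theory.OEF ⊆ Theory.OEFDC ∧
      ∀ (N : Type) [Language.orderedExpRing.Structure N] [LE N]
        [Language.orderedExpRing.OrderedStructure N], N ⊨ Theory.OEFDC →
          Language.orderedExpRing.IsDefinablyComplete N :=
  ⟨OEFDC_subset_realExpTheory, OEFDC_isRecursive, Set.subset_union_left, fun _ _ _ _ hN =>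
    DefinableCompleteness.model_scheme_iff_isDefinablyComplete.1 (hN.mono Set.subset_union_right)⟩

end Literature.ModelTheory.ExponentialFields
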